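import Summits.BirchSwinnertonDyer.Rank1Residual.WAll.TargetPrimeSlices
import HarnessLib
import HarnessLib.Audit.Tags

/-!
# Rung W-ALL of ladder BSD (D-0120) — PRIME SLICES of row 12r (CM, `r = 1`, odd RAMIFIED `p`) of the
# closed list (cell `bsd-wall`, lane (2), seat `bsd-wall-ty-1`; new small file importing
# `WAll.TargetPrimeSlices`)

HONEST FRAMING (cell `bsd-wall`, run/shared/lean/pub/bsd-wall/; brief `WALL-BRIEF-v1.md` sha16
b966bf16da27706e §2; WALL-TABLE.md row 12): STATEMENTS AND BOOKKEEPING ONLY — nothing asserted,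
nothing booked, no named fact, no published theorem restated; every `@[conjecture] def` below is an
OPEN obligation and a SLICE of the already-registered row-12 sub-leaf
`Summit.BirchSwinnertonDyer.WAllCornerFRamified` of `Rank1Residual/WAll/Target.lean` (row 12 K12r:
CM, `ord_{s=1} L(E,s) = 1`, `p` odd and ramified in the CM field — then `p` is bad,
`X12.not_good_of_cmRamified`), cut by the prime exactly as its sibling `WAllCornerFInertBad` is cut in
`WAll/TargetPrimeSlices.lean` (`WAllCornerFInertBadAtThree` / `…FiveLe`, `wAllCornerFInertBad_iff_three_fiveLe`).

WHY (director-bsd g8 ruling 2026-08-27T09:31:17Z on bsd-wall-cm g4's K12r@3 scoping memo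
`HOME/bsd-wall-cm/K12R3-SCOPING-v1.md` sha16 5284deb452ccfff0, "found-nothing ACCEPTED as an honest
outcome … (a) K12r@3 STAYS a DECLARED RESIDUAL of row 12 (W-ALL conjunction leaf by name; one-line
reason = memo §6a) … (c) p ≥ 11 ramified = K7r p-generic"): the declared residual K12r@3 — CM by
`ℚ(√−3)`, the only CM field of a curve over `ℚ` in which `3` ramifies, `r = 1`; census (cm g4, local
Cremona scan, N < 5·10⁵) 1 976 curves / 919 classes, all additive at `3`, `3 ∣ Ш_an` for 2/919 only
(309123c1/d1), smallest 225a1, 243a1, 432b1, 441b1; named missing tool «equivariant two-variable main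
conjecture / leading-term law at `p ∣ w_K`» (frontier card `equivariant-elliptic-units-ramified-three-cm`)
— gets its OWN leaf name `WAllCornerFRamifiedAtThree`, and the rest of the sub-row (`p ≥ 5`: in fact
`p ∈ {7, 11, 19, 43, 67, 163}` for the thirteen CM `j`-invariants, `Rank1Residual.cmFieldDiscrOfJ`; the
open route `RamifiedSevenEllipticUnits` closes rung K7r `X12.CMRamifiedSeven` = the class `𝒞₇` inside the
`p = 7` part, `Rank1Residual.WAll.cornerF_classCSeven_of_cmRamifiedSeven`) is `WAllCornerFRamifiedFiveLe`.
The cut is by `p = 3 | 5 ≤ p` (exact for an odd prime, no CM theory needed), not by the finer list of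
ramified primes, so that the glue is unconditional bookkeeping.

CONTENTS: §1 the two slice leaves; §2 glue — `wAllCornerFRamified_iff_three_fiveLe` (row 12r ⟺ its
two slices, EXACT), `wAllCornerFRamifiedAtThree_iff_three` (the `p = 3` instance form),
`wAllCornerF_iff_two_ramifiedSlices_inertBadSlices` (row 12 ⟺ K12₂ ∧ (12r@3 ∧ 12r@≥5) ∧ (12i@3 ∧ 12i@≥5),
over `wAllCornerF_iff` and `wAllCornerFInertBad_iff_three_fiveLe`); §3 both slices ⇐ `WAll`, and the
row-12 reassembly `wAllCornerF_of_fiveSlices` a registry consumes (feed its output as the `hF…` binders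
of `Rank1Residual.WAll.wAll_of_slicedLeaves_primaryGZ` / `Summit.BirchSwinnertonDyer.wAll_of_liveRouteLeaves_primaryGZ`
via `wAllCornerFRamified_iff_three_fiveLe`).

References: `Rank1Residual/WAll/Target.lean` (p488678; `WAllCornerF`, `WAllCornerFTwo`,
`WAllCornerFRamified`, `WAllCornerFInertBad`), `…/WAll/Conjunction.lean` (p488953; `wAllCornerF_iff`),
`…/WAll/TargetPrimeSlices.lean` (p503270; the 12i slices), `…/WAll/AltClosers.lean` §F
(`cornerF_of_subcases`, `cornerF_classCSeven_of_cmRamifiedSeven`),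
`Literature/NumberTheory/EllipticCurves/Rank1Residual/Predicates.lean` (`CMRamified`, `cmFieldDiscrOfJ`);
cell documents `HOME/bsd-wall-cm/K12R3-SCOPING-v1.md`, WALL-BRIEF-v1.md §2; [cite: Miller2011LMS, §1 and
Def. 1.1] (the currency `BSD(E,p)`).
-/

noncomputable section

open scoped Classical

open WeierstrassCurve Literature.NumberTheory.EllipticCurves
  Literature.NumberTheory.EllipticCurves.Rank1Residual Literature.NumberTheory.EllipticCurves.ModularForms
open Summit.BirchSwinnertonDyer.Rank1Residual

set_option autoImplicit false

namespace Summit.BirchSwinnertonDyer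

/-! ### §1. Row 12r (CM, `r = 1`, odd ramified `p`) sliced by prime `3 | ≥ 5` -/

/-- **Row 12r at `p = 3` (OPEN) — the declared residual K12r@3.** `p = 3`, CM, `ord_{s=1} L(E,s) = 1`,
`3` ramified in the CM field (i.e. CM by an order of `ℚ(√−3)`; then `3` is a bad, additive prime) ⇒
`BSD(E,3)`. Census (N < 5·10⁵): 1 976 curves / 919 classes; no printed theorem and no open route
attacks it (cm g4 memo K12R3-SCOPING-v1 §3: six architectures each excluded by a named hypothesis;
director-bsd 2026-08-27T09:31:17Z (a)). [folklore] -/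
@[conjecture] def WAllCornerFRamifiedAtThree : Prop :=
  ∀ (W : WeierstrassCurve ℚ) [W.IsElliptic] [W.IsGloballyMinimal] (p : ℕ) [Fact p.Prime],
    p = 3 → W.HasCM → W.analyticRank = 1 → CMRamified W p → BSDp W p

/-- **Row 12r at `p ≥ 5` (OPEN).** `5 ≤ p`, CM, `ord_{s=1} L(E,s) = 1`, `p` ramified in the CM field
(so `p ∈ {7, 11, 19, 43, 67, 163}`) ⇒ `BSD(E,p)`. The `p = 7` class `𝒞₇` (CM by `ℚ(√−7)`, good
ordinary at `2`, every bad `q ≠ 7` split) is rung K7r `X12.CMRamifiedSeven` of the open route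
`RamifiedSevenEllipticUnits`; `p ≥ 11` is "K7r `p`-generic" (director-bsd 2026-08-27T09:31:17Z (c)).
[folklore] -/
@[conjecture] def WAllCornerFRamifiedFiveLe : Prop :=
  ∀ (W : WeierstrassCurve ℚ) [W.IsElliptic] [W.IsGloballyMinimal] (p : ℕ) [Fact p.Prime],
    5 ≤ p → W.HasCM → W.analyticRank = 1 → CMRamified W p → BSDp W p

/-! ### §2. Glue: row 12r is EXACTLY the conjunction of its slices (no mathematics) -/

/-- **Row 12r ⟺ its `p = 3` slice ∧ its `p ≥ 5` slice** (an odd prime is `3` or `≥ 5`). [folklore] -/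
theorem wAllCornerFRamified_iff_three_fiveLe :
    WAllCornerFRamified ↔ WAllCornerFRamifiedAtThree ∧ WAllCornerFRamifiedFiveLe := by
  constructor
  · intro h
    exact ⟨fun W _ _ p _ hp3 hcm hr1 hram ↦ h W p hcm hr1 (by omega) hram,
      fun W _ _ p _ hp5 hcm hr1 hram ↦ h W p hcm hr1 (by omega) hram⟩
  · rintro ⟨h3, h5⟩ W _ _ p _ hcm hr1 hp2 hram
    by_cases hp3 : p = 3
    · exact h3 W p hp3 hcm hr1 hram
    · exact h5 W p ((Fact.out : p.Prime).five_le_of_ne_two_of_ne_three hp2 hp3) hcm hr1 hram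

/-- `WAllCornerFRamifiedAtThree` is a statement about `BSD(E,3)` (the `p = 3` instance). [folklore] -/
theorem wAllCornerFRamifiedAtThree_iff_three :
    WAllCornerFRamifiedAtThree ↔
      ∀ (W : WeierstrassCurve ℚ) [W.IsElliptic] [W.IsGloballyMinimal],
        W.HasCM → W.analyticRank = 1 → CMRamified W 3 → BSDp W 3 := by
  constructor
  · intro h W _ _ hcm hr1 hram
    exact h W 3 rfl hcm hr1 hram
  · intro h W _ _ p _ hp3 hcm hr1 hram
    subst hp3
    exact h W hcm hr1 hram

/-- **Row 12 ⟺ K12₂ ∧ (12r@3 ∧ 12r@≥5) ∧ (12i@3 ∧ 12i@≥5)** — the whole CM corner at slice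
granularity, over `wAllCornerF_iff` (Conjunction.lean) and `wAllCornerFInertBad_iff_three_fiveLe`
(TargetPrimeSlices.lean). [folklore] -/
theorem wAllCornerF_iff_two_ramifiedSlices_inertBadSlices :
    WAllCornerF ↔ WAllCornerFTwo ∧ (WAllCornerFRamifiedAtThree ∧ WAllCornerFRamifiedFiveLe) ∧
      (WAllCornerFInertBadAtThree ∧ WAllCornerFInertBadFiveLe) := by
  rw [wAllCornerF_iff, wAllCornerFRamified_iff_three_fiveLe, wAllCornerFInertBad_iff_three_fiveLe]

/-! ### §3. Both slices follow from `WAll`; the five slices reassemble row 12 -/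

/-- The two slices of this file from `WAll` (each is an instance of it). [folklore] -/
theorem cmRamifiedSlices_of_wAll (h : WAll) :
    WAllCornerFRamifiedAtThree ∧ WAllCornerFRamifiedFiveLe :=
  ⟨fun W _ _ p _ _ _ hr1 _ ↦ h W p (by omega), fun W _ _ p _ _ _ hr1 _ ↦ h W p (by omega)⟩

/-- **Row 12 from its five slices** — the form a leaf registry consumes (`hF2` = K12₂ `WAllCornerFTwo`,
`hR3`/`hR5` = this file's 12r slices, `hI3`/`hI5` = the 12i slices of TargetPrimeSlices.lean).
[folklore] -/
theorem wAllCornerF_of_fiveSlices (hF2 : WAllCornerFTwo)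
    (hR3 : WAllCornerFRamifiedAtThree) (hR5 : WAllCornerFRamifiedFiveLe)
    (hI3 : WAllCornerFInertBadAtThree) (hI5 : WAllCornerFInertBadFiveLe) : WAllCornerF :=
  wAllCornerF_iff_two_ramifiedSlices_inertBadSlices.mpr ⟨hF2, ⟨hR3, hR5⟩, ⟨hI3, hI5⟩⟩

/-- The row-12r leaf from its two slices (the one-liner a registry taking `hFr : WAllCornerFRamified`
— e.g. `Summit.BirchSwinnertonDyer.wAll_of_liveRouteLeaves_primaryGZ`,
`Rank1Residual.WAll.wAll_of_slicedLeaves_primaryGZ` — is fed with). [folklore] -/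
theorem wAllCornerFRamified_of_slices (hR3 : WAllCornerFRamifiedAtThree)
    (hR5 : WAllCornerFRamifiedFiveLe) : WAllCornerFRamified :=
  wAllCornerFRamified_iff_three_fiveLe.mpr ⟨hR3, hR5⟩

end Summit.BirchSwinnertonDyer

end
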